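/-
Origin: expansion seat `planner-pub-hodgecm-pv07-g5-0`, handover #2 2026-08-18T12:47:03Z (md5 65dfe92172fd1ef1e5274e866013d91a; NEW additive leaf; TWO import rewrites by the generic ^import Pv[0-9]+g[0-9]+\. -> import HodgeCM.PerL34. rule: Pv07g5.GenuineTransfer (my #1), Pv07g4.GenuineSchrodingerShift (RUN-29 row 44deaca5, landed); land AFTER my #1) (`HOME/pub-hodgecm-pv07-g5/lean/Pv07g5/GenuineSchrodingerEmbed.lean`, md5 65dfe921, 156 lines);
landed by the gen-8 packager in gate run 30 as `HodgeCM/PerL34/GenuineSchrodingerEmbed.lean` (import ^import Pv07g5\.GenuineTransfer[ \t]*$→import HodgeCM.PerL34.GenuineTransfer ×1; import ^import Pv07g4\.GenuineSchrodingerShift[ \t]*$→import HodgeCM.PerL34.GenuineSchrodingerShift ×1).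
-/
/-
Copyright: HodgeCM publication cell (pub-hodgecm), DAG node N31 (seam S3, PerL v5 Lemma 4.2(b)) — the S3 END fed by
the genuine split Schrödinger model THROUGH AN EMBEDDING into the doubling datum's space.  Prover seat
pub-hodgecm-pv07-g5 (DAG-node prover #07, generation 5), file #2 (HANDOVER #2).  Released under the package licence.

WIP imports: `Pv07g5.GenuineTransfer` ↦ `HodgeCM.PerL34.GenuineTransfer` (this seat, HANDOVER #1);
`Pv07g4.GenuineSchrodingerShift` ↦ `HodgeCM.PerL34.GenuineSchrodingerShift` (pv07-g4 HANDOVER #2, RUN 29).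
Complete proofs, no new axioms, nothing cited, no hypothesis posited.
-/
import Summits.HodgeConjecture.HodgeCM.PerL34.GenuineTransfer
import Summits.HodgeConjecture.HodgeCM.PerL34.GenuineSchrodingerShift_2

/-!
# Lemma 4.2(b), torus side: the concrete model embedded in the datum

pv07-g4 #3 (`GenuineSchrodingerEnd`) applies pv09-g5's S3 END to a doubling datum `D` typed ON the model space
`L²(X)` with `hω : D.ω = rep L (twistChar L χ)`.  Here the same torus side (pv13-g4 #6 + pv07-g4 #1/#2:
`torusSideShift` — unit vector `φ_e`, level, product formula, `GenuineThetaInput` at every finite `S`, all THEOREMS of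
the concrete model) feeds the END for a datum `D` on ANY inner-product space `Sp` through an isometric
`Model L`-equivariant embedding `E : L²(X) →ₗᵢ[ℂ] Sp`, `E ∘ rep L (twistChar L χ) (g) = D.ω g ∘ E` (#1 of this seat,
`exists_compactDomain_thetaLift_ne_zero_genuine_of_embedding`): the genuine theta lift of `E φ_e` paired with `χ` is
non-zero on a compact fundamental domain.  Left on the representation side: only the datum's strong continuity `hloc`
on `Sp` (pv09-g5's binder, a property of the genuine Weil representation, not of the model).

`exists_compactDomain_thetaLift_ne_zero_genuine_shift_of_eq` re-derives pv07-g4 #3's statement as the case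
`Sp = L²(X)`, `E = id` (consistency check by name; #3 itself is not imported).

ABSOLUTE RULE respected: nothing cited; every hypothesis is data, a hypothesis of pv09-g5's END passed through
unchanged, or the equivariance equation `hE`.
-/

set_option linter.style.longFile 0
set_option linter.unusedSectionVars false
set_option linter.unusedVariables false

noncomputable section

open MeasureTheory MeasureTheory.Measure Set Metric Function Complex ComplexConjugate Topology Filter
open scoped RestrictedProduct InnerProductSpace NNReal ENNReal Pointwise

namespace HodgeCM.PerL34.PureTensor

open HodgeCM.PerL34.SplitShells HodgeCM.PerL34.AdelicFactorisation HodgeCM.PerL34.RestrictedMeasure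
open HodgeCM.PerL34.NoSmallSubgroups HodgeCM.PerL34.EulerFactorisation HodgeCM.PerL34.DiscreteFD
open HodgeCM.PerL34.LocalFactors HodgeCM.PerL34.LocalFactors.DilationModel
open HodgeCM.PerL34.LocalModulus HodgeCM.PerL34.SplitPlaceDilation
open HodgeCM.PerL34.RallisIP HodgeCM.PerL34.Doubling HodgeCM.PerL34.N31d NumberField IsDedekindDomain
open HodgeCM.PerL34.IdelePlaces HodgeCM.PerL34.RestrictedRegroup HodgeCM.PerL34.RestrictedCutout
open HodgeCM.PerL34.IdelicTorusModel HodgeCM.PerL34.IdelicTorusModel.Genuine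

attribute [local instance] LocalFactors.DilationModel.Adic.nontriviallyNormedField
  LocalFactors.DilationModel.Adic.properSpace

namespace SchrodingerModel

namespace Coeff

variable (L : Type) [Field L] [NumberField L] [IsCMField L]

local notation3 "L⁺" => maximalRealSubfield L

set_option synthInstance.maxHeartbeats 200000 in
-- (as in the END theorem: the `SMul Γ (Model L)` instance behind `IsFundamentalDomain` is slow to find)
/-- **S3 END with the torus side discharged by the genuine split Schrödinger model, ALONG AN EMBEDDING.**
For a CM field `L`, a finite set `S` of places of `L⁺` containing the infinite places, a character `χ` of the model
group with level `T' ⊆ S`, a doubling datum `D` on ANY space `Sp` with strongly continuous `D.ω` (+ the END's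
theta-side data and print inputs, unchanged) and an isometric equivariant embedding `E : L²(X) →ₗᵢ[ℂ] Sp` of the model
representation `rep L (twistChar L χ)` into `D.ω`: the END's conclusion for the vector `E φ_e`,
`φ_e = phiE (shiftFor S χ hχT' hlocχ)` (bookkeeping-free choice: `S := levelPlaces L T'`, pv07-g4 #3, with
`subset_levelPlaces` / `inl_mem_levelPlaces`). -/
theorem exists_compactDomain_thetaLift_ne_zero_genuine_embed [DecidableEq (Place L⁺)]
    [∀ v : HeightOneSpectrum (𝓞 L⁺), MeasurableSpace (v.adicCompletion L⁺)]
    [∀ v : HeightOneSpectrum (𝓞 L⁺), BorelSpace (v.adicCompletion L⁺)]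
    (S₀ : Finset (Place L⁺))
    {Sp : Type} [NormedAddCommGroup Sp] [InnerProductSpace ℂ Sp]
    {W : Type} [AddCommGroup W] [Module L W]
    {H Sbox : Type} [Group H] [AddCommGroup Sbox] [Module ℂ Sbox]
    {h : W →ₗ⋆[L] W →ₗ[L] L} (hW : IsLine L W) (hh : Anisotropic h)
    (D : DoublingDatum (Model L) H Sp Sbox) (GU : ThetaSide Sp Sbox)
    (j : isomBox h →* H) (hj : ∀ d : unitary L, j ⟨iotaSnd d, iotaSnd_mem h d⟩ = D.ι (1, unitaryToModel L d))
    (χ : Model L →* Circle) (hχΓ : ∀ d : unitary L, χ (unitaryToModel L d) = 1)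
    (hχVΓ : ∀ d : unitary L, D.χV (unitaryToModel L d) = 1)
    {hP : ∀ Ψ : Sbox, ∀ p ∈ (stabDelta L W).subgroupOf (isomBox h), ∀ x : H, D.fSW Ψ (j p * x) = D.fSW Ψ x}
    (P : GluePrintInputs D GU h j hP)
    (hloc : ∀ (i : Place L⁺) (v : Sp),
      Continuous fun g : locTorus L⁺ L i => D.ω (RestrictedProduct.mulSingle (genLevel L) i g) v)
    {T' : Finset (Place L⁺)} (hχT' : RestrictedProduct.boxSubgroup (genLevel L) T' ≤ χ.ker)
    (hlocχ : ∀ i ∈ T', Continuous fun g : locTorus L⁺ L i => χ (RestrictedProduct.mulSingle (genLevel L) i g))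
    {S : Finset (Place L⁺)} (hT'S : T' ⊆ S) (hS : ∀ v : InfinitePlace L⁺, Sum.inl v ∈ S)
    (E : Lp ℂ 2 (μ L) →ₗᵢ[ℂ] Sp) (hE : ∀ (g : Model L) (v : Lp ℂ 2 (μ L)), E (rep L (twistChar L χ) g v) = D.ω g (E v))
    [IsFiniteMeasure GU.μ] :
    ∃ 𝓕 : Set (Model L), IsCompact 𝓕 ∧ (interior 𝓕).Nonempty ∧ MeasurableSet 𝓕 ∧
      IsFundamentalDomain (unitaryToModel L).range 𝓕
        (haarDatum (genLevel L) (isCompact_genLevel L) (isOpen_genLevel L) S₀).μ ∧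
      (haarDatum (genLevel L) (isCompact_genLevel L) (isOpen_genLevel L) S₀).μ 𝓕 ≠ 0 ∧
      (haarDatum (genLevel L) (isCompact_genLevel L) (isOpen_genLevel L) S₀).μ 𝓕 ≠ ⊤ ∧
      ∀ [IsFiniteMeasure (((haarDatum (genLevel L) (isCompact_genLevel L) (isOpen_genLevel L) S₀).μ).restrict 𝓕)]
        (hk : Measurable (Function.uncurry (thetaFn D GU (E (phiE (shiftFor S χ hχT' hlocχ)))))) {Ck : ℝ}
        (hCk : 0 ≤ Ck) (hkC : ∀ q u, ‖thetaFn D GU (E (phiE (shiftFor S χ hχT' hlocχ))) q u‖ ≤ Ck),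
        PeterssonFubini.theta GU.μ
          (((haarDatum (genLevel L) (isCompact_genLevel L) (isOpen_genLevel L) S₀).μ).restrict 𝓕) hk
          (measurable_coe_char (genLevel L) (isOpen_genLevel L) χ hχT' hlocχ) hCk hkC (norm_coe_char_le χ) ≠ 0 := by
  obtain ⟨⟨X⟩, hφ, -, hK, hM⟩ := torusSideShift S χ hχT' hlocχ hT'S
  exact exists_compactDomain_thetaLift_ne_zero_genuine_of_embedding L S₀ hW hh D GU j hj χ hχΓ hχVΓ P hloc hχT' hlocχ
    (rep L (twistChar L χ)) (phiE (shiftFor S χ hχT' hlocχ)) hφ hK hM subset_rfl hT'S hS X E hE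

set_option synthInstance.maxHeartbeats 200000 in
/-- **Consistency check by name: pv07-g4 #3 is the case `Sp = L²(X)`, `E = id`.**  The statement of
`exists_compactDomain_thetaLift_ne_zero_genuine_shift` re-derived from the embedding form (`hloc` from the model's
`torusSideShift`, `hE` from `hω`). -/
theorem exists_compactDomain_thetaLift_ne_zero_genuine_shift_of_eq [DecidableEq (Place L⁺)]
    [∀ v : HeightOneSpectrum (𝓞 L⁺), MeasurableSpace (v.adicCompletion L⁺)]
    [∀ v : HeightOneSpectrum (𝓞 L⁺), BorelSpace (v.adicCompletion L⁺)]
    (S₀ : Finset (Place L⁺))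
    {W : Type} [AddCommGroup W] [Module L W]
    {H Sbox : Type} [Group H] [AddCommGroup Sbox] [Module ℂ Sbox]
    {h : W →ₗ⋆[L] W →ₗ[L] L} (hW : IsLine L W) (hh : Anisotropic h)
    (D : DoublingDatum (Model L) H (Lp ℂ 2 (μ L)) Sbox) (GU : ThetaSide (Lp ℂ 2 (μ L)) Sbox)
    (j : isomBox h →* H) (hj : ∀ d : unitary L, j ⟨iotaSnd d, iotaSnd_mem h d⟩ = D.ι (1, unitaryToModel L d))
    (χ : Model L →* Circle) (hχΓ : ∀ d : unitary L, χ (unitaryToModel L d) = 1)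
    (hχVΓ : ∀ d : unitary L, D.χV (unitaryToModel L d) = 1)
    {hP : ∀ Ψ : Sbox, ∀ p ∈ (stabDelta L W).subgroupOf (isomBox h), ∀ x : H, D.fSW Ψ (j p * x) = D.fSW Ψ x}
    (P : GluePrintInputs D GU h j hP)
    {T' : Finset (Place L⁺)} (hχT' : RestrictedProduct.boxSubgroup (genLevel L) T' ≤ χ.ker)
    (hlocχ : ∀ i ∈ T', Continuous fun g : locTorus L⁺ L i => χ (RestrictedProduct.mulSingle (genLevel L) i g))
    {S : Finset (Place L⁺)} (hT'S : T' ⊆ S) (hS : ∀ v : InfinitePlace L⁺, Sum.inl v ∈ S)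
    (hω : D.ω = rep L (twistChar L χ)) [IsFiniteMeasure GU.μ] :
    ∃ 𝓕 : Set (Model L), IsCompact 𝓕 ∧ (interior 𝓕).Nonempty ∧ MeasurableSet 𝓕 ∧
      IsFundamentalDomain (unitaryToModel L).range 𝓕
        (haarDatum (genLevel L) (isCompact_genLevel L) (isOpen_genLevel L) S₀).μ ∧
      (haarDatum (genLevel L) (isCompact_genLevel L) (isOpen_genLevel L) S₀).μ 𝓕 ≠ 0 ∧
      (haarDatum (genLevel L) (isCompact_genLevel L) (isOpen_genLevel L) S₀).μ 𝓕 ≠ ⊤ ∧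
      ∀ [IsFiniteMeasure (((haarDatum (genLevel L) (isCompact_genLevel L) (isOpen_genLevel L) S₀).μ).restrict 𝓕)]
        (hk : Measurable (Function.uncurry (thetaFn D GU (phiE (shiftFor S χ hχT' hlocχ))))) {Ck : ℝ} (hCk : 0 ≤ Ck)
        (hkC : ∀ q u, ‖thetaFn D GU (phiE (shiftFor S χ hχT' hlocχ)) q u‖ ≤ Ck),
        PeterssonFubini.theta GU.μ
          (((haarDatum (genLevel L) (isCompact_genLevel L) (isOpen_genLevel L) S₀).μ).restrict 𝓕) hk
          (measurable_coe_char (genLevel L) (isOpen_genLevel L) χ hχT' hlocχ) hCk hkC (norm_coe_char_le χ) ≠ 0 := by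
  obtain ⟨-, -, hloc, -, -⟩ := torusSideShift S χ hχT' hlocχ hT'S
  have hloc' : ∀ (i : Place L⁺) (v : Lp ℂ 2 (μ L)),
      Continuous fun g : locTorus L⁺ L i => D.ω (RestrictedProduct.mulSingle (genLevel L) i g) v := by
    rw [hω]; exact hloc
  have hE : ∀ (g : Model L) (v : Lp ℂ 2 (μ L)),
      (LinearIsometry.id : Lp ℂ 2 (μ L) →ₗᵢ[ℂ] Lp ℂ 2 (μ L)) (rep L (twistChar L χ) g v)
        = D.ω g ((LinearIsometry.id : Lp ℂ 2 (μ L) →ₗᵢ[ℂ] Lp ℂ 2 (μ L)) v) := by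
    intro g v; rw [hω]; rfl
  exact exists_compactDomain_thetaLift_ne_zero_genuine_embed L S₀ hW hh D GU j hj χ hχΓ hχVΓ P hloc' hχT' hlocχ hT'S hS
    (LinearIsometry.id : Lp ℂ 2 (μ L) →ₗᵢ[ℂ] Lp ℂ 2 (μ L)) hE

end Coeff

end SchrodingerModel

end HodgeCM.PerL34.PureTensor

end
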